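import Mathlib
import Summits.ValiantsHypothesis.ValiantsHypothesis.Theorems.NewtonUnitEquationsTwoProductsConfinedTameLawDefs
import Summits.ValiantsHypothesis.ValiantsHypothesis.Theorems.NewtonUnitEquationsTwoProductsRaySplitDefs
import Summits.ValiantsHypothesis.ValiantsHypothesis.Theorems.TwoProducts.Negative.RaySplitResidual
import Summits.ValiantsHypothesis.ValiantsHypothesis.Theorems.TwoProducts.Negative.DirectionGadgets
import HarnessLib

/-!
# NEGATIVE lane (val-neg-1 g5): the residual after a «ray letters on `K ≤ C` rays, free letters confined» rung is `PlanarCellBound` again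

Helper file for crux `stmt-ValiantsHypothesis-5906` (filed `--supports`; closes NO item, proves NO summit statement, does NOT prove
`TwoProducts`, `PlanarCellBound`, `ResidualLawV22/V23/V24`, `ConfinedTameLaw`, `RaySplitLaw`, a Stage-2 ray-split law or VP ≠ VNP; 0 `def`s).

R11 Stage 2 (val-idea-32 card l.53–58; typed by val-idea-crit-8 g2 as `RaySplitFreeLaw (C)` / hatch `¬ RaySplitFreeStructure C u v`):
ray letters `L` on `K ≤ C` rays (`OnRays g ι ν (tailSupport ∩ L)`, in-ray multiplicity `≤ (m+2)^C`), free letters moved by no coincidence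
(`R10Defs.LetterConfined _ L`), no cross-ray coincidence (`RayCrossFree ι _`).  THIS FILE: for every fixed `C`, the residual law carrying
the v23 hypotheses at level `C` AND the negation of that structure is EQUIVALENT to `PlanarCellBound`
(`residualNotRaySplitFree_iff_planarCellBound`).  Mechanism = p662518's tower instance with the directions padding replaced by the
DIRECTION GADGETS padding of `Negative/DirectionGadgets.lean`: gadget `i` plants a two-position coincidence moving the letter `d i`, so every
confining `L` contains all `d i` (`mem_of_letterConfined`, applied in the FINAL family, where the gadget positions keep their letter sets),
and the `C+1` pairwise non-parallel `d i ∈ tailSupport ∩ L` lie on no `K ≤ C` rays (`not_onRays_of_directions`; parallel rays allowed,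
`ν`-bound and `RayCrossFree` unused).  Exponents `(a, b) ↦ (a(18C+27), b + a(2(576C+608) + 18(C+1)(C+36)) + a(18C+27)(2C+2))`.
READING: Stage 2, like Stage 1 and R8–R10, is a proper positive sub-case; the law owed after it is, for every `C`, `PlanarCellBound`.  [folklore]
-/

namespace Summit.ValiantsHypothesis.Theorems.TwoProducts.Negative.RaySplitFreeResidual

open Finset MvPolynomial
open Summit.ValiantsHypothesis.ValiantsHypothesis.Theorems.NewtonUnitEquations.TwoProducts.FormalLogLinearisation
open Summit.ValiantsHypothesis.ValiantsHypothesis.Theorems.NewtonUnitEquations.TwoProducts.PlanarCell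
open Summit.ValiantsHypothesis.ValiantsHypothesis.Theorems.NewtonUnitEquations.TwoProducts.PermutationType
open Summit.ValiantsHypothesis.ValiantsHypothesis.Theorems.NewtonUnitEquations.TwoProducts.RaySplit
open Summit.ValiantsHypothesis.Theorems.TwoProducts.Negative.CommonPadding
open Summit.ValiantsHypothesis.Theorems.TwoProducts.Negative.FullPadding (fullPadding_spec fullPadding_letters fullPadding_noDatum)
open Summit.ValiantsHypothesis.Theorems.TwoProducts.Negative.FullPaddingThresholds (fullPadding_noSmallPermMerge fullPadding_noCheapCover)
open Summit.ValiantsHypothesis.Theorems.TwoProducts.Negative.FullPaddingResidual (fullPadding_condition)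
open Summit.ValiantsHypothesis.Theorems.TwoProducts.Negative.TowerPadding
open Summit.ValiantsHypothesis.Theorems.TwoProducts.Negative.TowerPaddingResidual
  (tower_threshold tower_cost tower_pos_ne two_le_two_pow_succ)
open Summit.ValiantsHypothesis.Theorems.TwoProducts.Negative.DirectionsPadding (not_raySplit_of_directions)
open Summit.ValiantsHypothesis.Theorems.TwoProducts.Negative.RaySplitResidual (directions_cost)
open Summit.ValiantsHypothesis.Theorems.TwoProducts.Negative.DirectionGadgets

variable {m : ℕ}

/-- **Gadgets cost**: the law on `m + ((C+1)+(C+1))` positions read back on `m` positions. [folklore] -/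
theorem gadgets_cost (A B m C t : ℕ) (ht : 2 ≤ t + 2) :
    2 ^ (A * (m + (C + 1 + (C + 1)))) * (t + 2) ^ B ≤ 2 ^ (A * m) * (t + 2) ^ (B + A * (C + 1 + (C + 1))) := by
  rw [mul_add A m, pow_add, pow_add (t + 2)]
  calc 2 ^ (A * m) * 2 ^ (A * (C + 1 + (C + 1))) * (t + 2) ^ B = 2 ^ (A * m) * ((t + 2) ^ B * 2 ^ (A * (C + 1 + (C + 1)))) := by ring
    _ ≤ 2 ^ (A * m) * ((t + 2) ^ B * (t + 2) ^ (A * (C + 1 + (C + 1)))) :=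
        Nat.mul_le_mul_left _ (Nat.mul_le_mul_left _ (Nat.pow_le_pow_left ht _))

/-- **The post-Stage-2 residual law (level `C`) implies `PlanarCellBound`.** [folklore] -/
theorem planarCellBound_of_residualNotRaySplitFree (C : ℕ)
    (h : ∃ a b : ℕ, ∀ (m t : ℕ), 2 ≤ t → ∀ (u v : Fin m → MvPolynomial (Fin 2) ℂ),
      (∀ j, coeff 0 (u j) = 0 ∧ (u j).support.card ≤ t) → (∀ j, coeff 0 (v j) = 0 ∧ (v j).support.card ≤ t) →
      (∀ (J : Finset (Fin m)) (j₀ : Fin m), j₀ ∈ J →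
        BlockSmall (fun j => (u j).support ∪ (v j).support) J (2 ^ m * (t + 2) ^ 4) →
        ¬ PermType (mergeA (fun j => (u j).support ∪ (v j).support) J j₀)) →
      (∀ (r : ℕ) (Jc : Fin r → Finset (Fin m)) (ac bc : Fin r → Fin m → Expo),
        (∀ a ∈ tuples (fun j => (u j).support ∪ (v j).support), ∀ b ∈ tuples (fun j => (u j).support ∪ (v j).support),
          a ≠ b → ∑ j, a j = ∑ j, b j →
          ∃ k : Fin r, (∀ j, a j ≠ b j ↔ j ∈ Jc k) ∧
            ((∀ j ∈ Jc k, a j = ac k j ∧ b j = bc k j) ∨ (∀ j ∈ Jc k, a j = bc k j ∧ b j = ac k j))) →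
        2 ^ m * (t + 2) ^ 4 < 2 * (m + 1) * (3 * (2 + m + m.choose 2) ^ 2) ^ r) →
      (¬ ∃ ρp ρm : Expo →₀ ℕ, RankOneCoincidences (fun j => (u j).support ∪ (v j).support) ρp ρm) →
      (¬ ∃ L : Finset Expo, L.card ≤ C * m ∧
          R10Defs.LetterConfined (fun j => (u j).support ∪ (v j).support) L ∧
          R10Defs.FibreSpread (fun j => (u j).support ∪ (v j).support) L ((m + 2) ^ C)) →
      (¬ ∃ K : ℕ, K ≤ C ∧ ∃ (g : Fin K → Expo) (ι : Expo → Fin K) (ν : Expo → ℕ), IndepRays g ∧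
          OnRays g ι ν (tailSupport u v) ∧ RayCrossFree ι (fun j => (u j).support ∪ (v j).support)) →
      (¬ ∃ K : ℕ, K ≤ C ∧ ∃ (g : Fin K → Expo) (ι : Expo → Fin K) (ν : Expo → ℕ) (L : Finset Expo),
          OnRays g ι ν ((tailSupport u v).filter (· ∈ L)) ∧
          (∀ e ∈ tailSupport u v, e ∈ L → ν e ≤ (m + 2) ^ C) ∧
          R10Defs.LetterConfined (fun j => (u j).support ∪ (v j).support) L ∧
          RayCrossFree ι (fun j => (u j).support ∪ (v j).support)) →
      ∀ (R : Expo → Expo → Prop) (S : Finset Expo), IsCellFamily u v R S → S.card ≤ 2 ^ (a * m) * (t + 2) ^ b) :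
    ∃ a b : ℕ, ∀ (m t : ℕ), 2 ≤ t → ∀ (u v : Fin m → MvPolynomial (Fin 2) ℂ),
      (∀ j, coeff 0 (u j) = 0 ∧ (u j).support.card ≤ t) → (∀ j, coeff 0 (v j) = 0 ∧ (v j).support.card ≤ t) →
      ∀ (R : Expo → Expo → Prop) (S : Finset Expo),
        (∀ l ∈ S, ∃ ξ : Fin 2 → ℝ, ValidWeight u v ξ ∧ IsStrictTop ξ (logSupport u v) l ∧
          ∀ e ∈ ((Finset.univ.biUnion fun j => (u j).support) ∪ Finset.univ.biUnion fun j => (v j).support),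
          ∀ e' ∈ ((Finset.univ.biUnion fun j => (u j).support) ∪ Finset.univ.biUnion fun j => (v j).support),
            (R e e' ↔ wt ξ e ≤ wt ξ e')) →
        S.card ≤ 2 ^ (a * m) * (t + 2) ^ b := by
  classical
  obtain ⟨a, b, h⟩ := h
  refine ⟨a * (18 * C + 27), b + a * (2 * (576 * C + 608) + 18 * (C + 1) * (C + 36)) + a * (18 * C + 27) * (C + 1 + (C + 1)),
    fun m t ht u v hu hv R S hS => ?_⟩
  change IsCellFamily u v R S at hS
  rcases S.eq_empty_or_nonempty with rfl | hne
  · simp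
  -- step 0: `C+1` deep common coincidence gadgets in pairwise non-parallel directions
  obtain ⟨w₀, R₀, hu₀, hv₀, hS₀, -, d, hdmem, hdnp, hgad⟩ := directionGadgets_padding C ht u v hu hv R S hS hne
  obtain ⟨u₀, hu₀def⟩ : ∃ u₀ : Fin (m + (C + 1 + (C + 1))) → MvPolynomial (Fin 2) ℂ, u₀ = Fin.append u w₀ := ⟨_, rfl⟩
  obtain ⟨v₀, hv₀def⟩ : ∃ v₀ : Fin (m + (C + 1 + (C + 1))) → MvPolynomial (Fin 2) ℂ, v₀ = Fin.append v w₀ := ⟨_, rfl⟩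
  have hA₀ : ∀ p : Fin (C + 1 + (C + 1)), (u₀ (Fin.natAdd m p)).support ∪ (v₀ (Fin.natAdd m p)).support = (w₀ p).support := by
    intro p
    rw [hu₀def, hv₀def, Fin.append_right, Fin.append_right, Finset.union_idempotent]
  rw [← hu₀def] at hu₀ hS₀ hdmem
  rw [← hv₀def] at hv₀ hS₀ hdmem
  have hT := tailSupport_nonempty_of_isCellFamily hS₀ hne
  have hs0 := tailSum_ne_zero (fun j => (hu₀ j).1) (fun j => (hv₀ j).1) hT
  obtain ⟨Lg, hLg⟩ : ∃ Lg, Lg = Nat.log 2 (t + 2) := ⟨_, rfl⟩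
  obtain ⟨z₀, hz₀⟩ : ∃ z₀, z₀ = m + (C + 1 + (C + 1)) + 32 * (Lg + 1) + 36 + C := ⟨_, rfl⟩
  obtain ⟨H, hH⟩ : ∃ H, H = (C + 1) * z₀ := ⟨_, rfl⟩
  have hH1 : 1 ≤ H := by
    have : 0 < (C + 1) * z₀ := Nat.mul_pos (Nat.succ_pos C) (by omega)
    omega
  have hlt : t + 2 < 2 ^ (Lg + 1) := by rw [hLg]; exact Nat.lt_pow_succ_log_self (by norm_num) _
  have hle : 2 ^ Lg ≤ t + 2 := by rw [hLg]; exact Nat.pow_log_le_self 2 (by omega)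
  -- step 1: the common binary tower
  have hc2 : ∀ i : Fin H, 2 ≤ (fun i : Fin H => 2 ^ ((i : ℕ) + 1)) i := fun i => two_le_two_pow_succ i
  have hc0 : ∀ i : Fin H, (fun i : Fin H => 2 ^ ((i : ℕ) + 1)) i ≠ 0 := fun i => by have := hc2 i; simp only at this ⊢; omega
  obtain ⟨y, hy⟩ : ∃ y : Fin H → MvPolynomial (Fin 2) ℂ, y = fun i : Fin H =>
      monomial ((fun i : Fin H => 2 ^ ((i : ℕ) + 1)) i • ∑ f ∈ tailSupport u₀ v₀, f) (1 : ℂ) +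
        monomial ((2 * (fun i : Fin H => 2 ^ ((i : ℕ) + 1)) i) • ∑ f ∈ tailSupport u₀ v₀, f) 1 := ⟨_, rfl⟩
  obtain ⟨hu₁, hv₁, -, -, -, hcell₁⟩ := scaledPadding_spec ht _ hc2 u₀ v₀ hu₀ hv₀ hT y hy
  obtain ⟨R₁, hS₁⟩ := hcell₁ R₀ S hS₀
  have hlet := scaledPadding_letters (m := m + (C + 1 + (C + 1))) _ hc0 u₀ v₀ hs0 y hy
  obtain ⟨u₁, hu₁def⟩ : ∃ u₁ : Fin (m + (C + 1 + (C + 1)) + (H + H)) → MvPolynomial (Fin 2) ℂ, u₁ = Fin.append u₀ (Fin.append y y) := ⟨_, rfl⟩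
  obtain ⟨v₁, hv₁def⟩ : ∃ v₁ : Fin (m + (C + 1 + (C + 1)) + (H + H)) → MvPolynomial (Fin 2) ℂ, v₁ = Fin.append v₀ (Fin.append y y) := ⟨_, rfl⟩
  rw [← hu₁def] at hu₁ hS₁ hlet
  rw [← hv₁def] at hv₁ hS₁ hlet
  have hT₁ := tailSupport_nonempty_of_isCellFamily hS₁ hne
  have hs₁ := tailSum_ne_zero (fun j => (hu₁ j).1) (fun j => (hv₁ j).1) hT₁
  -- step 2: the full base-5 padding of the towered instance
  obtain ⟨k, hk⟩ : ∃ k, k = (m + (C + 1 + (C + 1)) + (H + H)) + 4 * (Lg + 1) := ⟨_, rfl⟩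
  have hC := fullPadding_condition hlt hk
  have hg2 : 2 ≤ 4 * k := by omega
  obtain ⟨z, hz⟩ : ∃ z : Fin (4 * k) → MvPolynomial (Fin 2) ℂ, z = fun i : Fin (4 * k) =>
      monomial ((2 * 5 ^ (i : ℕ)) • ∑ f ∈ tailSupport u₁ v₁, f) (1 : ℂ) +
        monomial ((2 * (2 * 5 ^ (i : ℕ))) • ∑ f ∈ tailSupport u₁ v₁, f) 1 := ⟨_, rfl⟩
  obtain ⟨hu', hv', -, -, -, hcell'⟩ := fullPadding_spec ht u₁ v₁ hu₁ hv₁ hT₁ z hz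
  obtain ⟨R', hS'⟩ := hcell' R₁ S hS₁
  have hnd := (fullPadding_noDatum u₁ v₁ hs₁ hg2 z hz).2
  -- the tower letters survive in the final family
  have hpq : ∀ i : Fin H, (Fin.castAdd (4 * k + 4 * k) (Fin.natAdd (m + (C + 1 + (C + 1))) (Fin.castAdd H i)) : Fin (m + (C + 1 + (C + 1)) + (H + H) + (4 * k + 4 * k))) ≠
      Fin.castAdd (4 * k + 4 * k) (Fin.natAdd (m + (C + 1 + (C + 1))) (Fin.natAdd H i)) := tower_pos_ne hH1
  have htw : ∀ i : Fin H,
      2 ^ ((i : ℕ) + 1) • ∑ f ∈ tailSupport u₀ v₀, f ∈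
        (Fin.append u₁ (Fin.append z z) (Fin.castAdd (4 * k + 4 * k) (Fin.natAdd (m + (C + 1 + (C + 1))) (Fin.castAdd H i)))).support ∪
          (Fin.append v₁ (Fin.append z z) (Fin.castAdd (4 * k + 4 * k) (Fin.natAdd (m + (C + 1 + (C + 1))) (Fin.castAdd H i)))).support ∧
      (2 * 2 ^ ((i : ℕ) + 1)) • ∑ f ∈ tailSupport u₀ v₀, f ∈
        (Fin.append u₁ (Fin.append z z) (Fin.castAdd (4 * k + 4 * k) (Fin.natAdd (m + (C + 1 + (C + 1))) (Fin.castAdd H i)))).support ∪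
          (Fin.append v₁ (Fin.append z z) (Fin.castAdd (4 * k + 4 * k) (Fin.natAdd (m + (C + 1 + (C + 1))) (Fin.castAdd H i)))).support ∧
      2 ^ ((i : ℕ) + 1) • ∑ f ∈ tailSupport u₀ v₀, f ∈
        (Fin.append u₁ (Fin.append z z) (Fin.castAdd (4 * k + 4 * k) (Fin.natAdd (m + (C + 1 + (C + 1))) (Fin.natAdd H i)))).support ∪
          (Fin.append v₁ (Fin.append z z) (Fin.castAdd (4 * k + 4 * k) (Fin.natAdd (m + (C + 1 + (C + 1))) (Fin.natAdd H i)))).support := by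
    intro i
    simp only [Fin.append_left]
    exact ⟨(hlet i).1.1, (hlet i).1.2, (hlet i).2.1⟩
  -- the direction letters survive in the final family
  have hsub₁ : tailSupport u₀ v₀ ⊆ tailSupport u₁ v₁ := by
    rw [hu₁def, hv₁def, tailSupport_append]; exact Finset.subset_union_left
  have hsub' : tailSupport u₁ v₁ ⊆ tailSupport (Fin.append u₁ (Fin.append z z)) (Fin.append v₁ (Fin.append z z)) := by
    rw [tailSupport_append]; exact Finset.subset_union_left
  -- the gadget coincidences survive in the final family: every confining letter set contains the direction letters
  have hdL : ∀ L : Finset Expo, R10Defs.LetterConfined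
      (fun j => (Fin.append u₁ (Fin.append z z) j).support ∪ (Fin.append v₁ (Fin.append z z) j).support) L → ∀ i, d i ∈ L := by
    intro L hLc i
    obtain ⟨p, q, hpq, b', c', d', hp, hq, hsum, hd0, hdb, hdc⟩ := hgad i
    have hP : ∀ r : Fin (C + 1 + (C + 1)),
        (Fin.append u₁ (Fin.append z z) (Fin.castAdd (4 * k + 4 * k) (Fin.castAdd (H + H) (Fin.natAdd m r)))).support ∪
          (Fin.append v₁ (Fin.append z z) (Fin.castAdd (4 * k + 4 * k) (Fin.castAdd (H + H) (Fin.natAdd m r)))).support =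
        (w₀ r).support := by
      intro r
      rw [Fin.append_left, Fin.append_left, hu₁def, hv₁def, Fin.append_left, Fin.append_left, hA₀]
    have hpq' : (Fin.castAdd (4 * k + 4 * k) (Fin.castAdd (H + H) (Fin.natAdd m p)) : Fin (m + (C + 1 + (C + 1)) + (H + H) + (4 * k + 4 * k))) ≠
        Fin.castAdd (4 * k + 4 * k) (Fin.castAdd (H + H) (Fin.natAdd m q)) := by
      intro h
      apply hpq
      have := congrArg Fin.val h
      simp only [Fin.val_castAdd, Fin.val_natAdd] at this
      exact Fin.ext (by omega)
    refine mem_of_letterConfined hLc hpq' (a := d i) (b := b') (c := c') (d := d') ?_ ?_ ?_ ?_ hsum hd0 hdb hdc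
    · rw [hP, hp]; exact Finset.mem_insert_self _ _
    · rw [hP, hp]; exact Finset.mem_insert_of_mem (Finset.mem_singleton_self _)
    · rw [hP, hq]; exact Finset.mem_insert_self _ _
    · rw [hP, hq]; exact Finset.mem_insert_of_mem (Finset.mem_singleton_self _)
  -- apply the law to the final instance
  exact (h (m + (C + 1 + (C + 1)) + (H + H) + (4 * k + 4 * k)) t ht _ _ hu' hv'
    (fullPadding_noSmallPermMerge (t := t) _ hs₁ (fullPadding_letters u₁ v₁ hs₁ z hz) hC)
    (fullPadding_noCheapCover (t := t) _ hs₁ (fullPadding_letters u₁ v₁ hs₁ z hz) hC)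
    (not_exists.2 fun ρp => not_exists.2 fun ρm => hnd ρp ρm)
    (fun ⟨L, _, hLc, hLf⟩ => tower_not_fibreSpread _ hs0 _ _ hpq htw hH1 L hLc _ (tower_threshold hz₀ hH rfl hk) hLf)
    (not_raySplit_of_directions _ _ d (fun i => hsub' (hsub₁ (hdmem i))) hdnp)
    (fun ⟨K, hK, g, ι, ν, L, hon, _, hLc, _⟩ => not_onRays_of_directions hK g ι ν _ d
      (fun i => Finset.mem_filter.2 ⟨hsub' (hsub₁ (hdmem i)), hdL L hLc i⟩) hdnp hon)
    R' S hS').trans ((tower_cost a b hz₀ hH rfl hk hle (by omega)).trans (gadgets_cost _ _ m C t (by omega)))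

/-- **Post-Stage-2 residual law (level `C`) ⇔ `PlanarCellBound`** as `∃ a b` laws. [folklore] -/
theorem residualNotRaySplitFree_iff_planarCellBound (C : ℕ) :
    (∃ a b : ℕ, ∀ (m t : ℕ), 2 ≤ t → ∀ (u v : Fin m → MvPolynomial (Fin 2) ℂ),
      (∀ j, coeff 0 (u j) = 0 ∧ (u j).support.card ≤ t) → (∀ j, coeff 0 (v j) = 0 ∧ (v j).support.card ≤ t) →
      (∀ (J : Finset (Fin m)) (j₀ : Fin m), j₀ ∈ J →
        BlockSmall (fun j => (u j).support ∪ (v j).support) J (2 ^ m * (t + 2) ^ 4) →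
        ¬ PermType (mergeA (fun j => (u j).support ∪ (v j).support) J j₀)) →
      (∀ (r : ℕ) (Jc : Fin r → Finset (Fin m)) (ac bc : Fin r → Fin m → Expo),
        (∀ a ∈ tuples (fun j => (u j).support ∪ (v j).support), ∀ b ∈ tuples (fun j => (u j).support ∪ (v j).support),
          a ≠ b → ∑ j, a j = ∑ j, b j →
          ∃ k : Fin r, (∀ j, a j ≠ b j ↔ j ∈ Jc k) ∧
            ((∀ j ∈ Jc k, a j = ac k j ∧ b j = bc k j) ∨ (∀ j ∈ Jc k, a j = bc k j ∧ b j = ac k j))) →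
        2 ^ m * (t + 2) ^ 4 < 2 * (m + 1) * (3 * (2 + m + m.choose 2) ^ 2) ^ r) →
      (¬ ∃ ρp ρm : Expo →₀ ℕ, RankOneCoincidences (fun j => (u j).support ∪ (v j).support) ρp ρm) →
      (¬ ∃ L : Finset Expo, L.card ≤ C * m ∧
          R10Defs.LetterConfined (fun j => (u j).support ∪ (v j).support) L ∧
          R10Defs.FibreSpread (fun j => (u j).support ∪ (v j).support) L ((m + 2) ^ C)) →
      (¬ ∃ K : ℕ, K ≤ C ∧ ∃ (g : Fin K → Expo) (ι : Expo → Fin K) (ν : Expo → ℕ), IndepRays g ∧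
          OnRays g ι ν (tailSupport u v) ∧ RayCrossFree ι (fun j => (u j).support ∪ (v j).support)) →
      (¬ ∃ K : ℕ, K ≤ C ∧ ∃ (g : Fin K → Expo) (ι : Expo → Fin K) (ν : Expo → ℕ) (L : Finset Expo),
          OnRays g ι ν ((tailSupport u v).filter (· ∈ L)) ∧
          (∀ e ∈ tailSupport u v, e ∈ L → ν e ≤ (m + 2) ^ C) ∧
          R10Defs.LetterConfined (fun j => (u j).support ∪ (v j).support) L ∧
          RayCrossFree ι (fun j => (u j).support ∪ (v j).support)) →
      ∀ (R : Expo → Expo → Prop) (S : Finset Expo), IsCellFamily u v R S → S.card ≤ 2 ^ (a * m) * (t + 2) ^ b) ↔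
    ∃ a b : ℕ, ∀ (m t : ℕ), 2 ≤ t → ∀ (u v : Fin m → MvPolynomial (Fin 2) ℂ),
      (∀ j, coeff 0 (u j) = 0 ∧ (u j).support.card ≤ t) → (∀ j, coeff 0 (v j) = 0 ∧ (v j).support.card ≤ t) →
      ∀ (R : Expo → Expo → Prop) (S : Finset Expo),
        (∀ l ∈ S, ∃ ξ : Fin 2 → ℝ, ValidWeight u v ξ ∧ IsStrictTop ξ (logSupport u v) l ∧
          ∀ e ∈ ((Finset.univ.biUnion fun j => (u j).support) ∪ Finset.univ.biUnion fun j => (v j).support),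
          ∀ e' ∈ ((Finset.univ.biUnion fun j => (u j).support) ∪ Finset.univ.biUnion fun j => (v j).support),
            (R e e' ↔ wt ξ e ≤ wt ξ e')) →
        S.card ≤ 2 ^ (a * m) * (t + 2) ^ b :=
  ⟨planarCellBound_of_residualNotRaySplitFree C,
    fun ⟨a, b, h⟩ => ⟨a, b, fun m t ht u v hu hv _ _ _ _ _ _ R S hS => h m t ht u v hu hv R S hS⟩⟩

end Summit.ValiantsHypothesis.Theorems.TwoProducts.Negative.RaySplitFreeResidual
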